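import Mathlib.RingTheory.Trace.Basic
import Summits.HodgeConjecture.CorCM.Census.TypeStabiliserFrobeniusUnitriangular
import Summits.HodgeConjecture.CorCM.Census.TypeStabiliserIndexTwoRank

/-!
# `d₂(G/𝒦)` is unbounded: Frobenius‑unitriangular groups over `𝔽_{2^{2^e}}` with `d₂ ≥ 2^e`

COR-CM (cell `pub-hodgecm2`), count-neutral kernel combinatorics by the census seat lit-andre-3 (gen 24; lane
TYPE-STABILISER-UNBOUNDED), sequel of `Census/TypeStabiliserIndexTwoRank.lean` (`indexTwoRank N = d₂(G/N)`,
`card_signChar_quotient`) and `Census/TypeStabiliserSubgroup.lean` (`stabGen c = 𝒦(G,c) = ⟨c, {g | c ∉ ⟨g⟩}⟩`).  An explicit family of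
finite `2`-groups (bookkeeping definitions with bodies: a field, a matrix shape, a `Set` of matrices, a `Subgroup`, three matrices, two homomorphisms) +
theorems, everything proved; no `Prop`-valued definition, no `decide`, no certificate, no named fact, no `sorry`.
HONEST FRAMING: `HC_CM` is NOT proved, here or anywhere in the tree; nothing here is a period or a headline.

THE QUESTION (lane memos `HOME/pub-hodgecm2-lit-andre-3/PORTFOLIO-lit-andre-3-g20….g23.md`, Q1).  In the closed form of the coinvariant
fibre `φ₂(G,c) + 1 + [|G|/2 even] = β(G,c) + d₂(G/𝒦)` (`Census/TypeStabiliserCharK.lean`) the excess term is `d₂ = d(G/𝒦(G,c))`, the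
`𝔽₂`-dimension of b09ʼs stabiliser characters `𝔛(G,c)`.  The atlases of gens 20–23 realised `d₂ ∈ {0,…,6}` (`6` by a Magnus-algebra
certificate) and left «is `d₂` bounded over all pairs `(G,c)`?» open.  THIS FILE: **`d₂` IS UNBOUNDED** — for every `e ≥ 1` an explicit
finite `2`-group `𝒰ₑ` with a central involution `c` and `d₂(𝒰ₑ/𝒦) ≥ 2^e` (`two_pow_le_indexTwoRank_stabGen`,
`exists_indexTwoRank_stabGen_ge`).

THE CONSTRUCTION (§1–§3).  Let `k = 𝔽_{2^t}` with `t = 2^e`, and let `𝒰ₑ ≤ GL_{t+1}(k)` be the upper unitriangular matrices `u` whose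
superdiagonal is a Frobenius orbit: `u_{r,r+1} = λ(u)^{2^r}` (`r < t`) for one scalar `λ(u) = u_{0,1} ∈ k` (`good`, `frobUT`; the other
entries are free).  This is a group (the superdiagonal of a product of unitriangular matrices is the sum of the superdiagonals, and
`x ↦ x^{2^r}` is additive), `λ : 𝒰ₑ → (k,+)` is a surjective homomorphism (`lamHom`, `lamHom_surjective`), and — the point —
**`u^t = 1 + λ(u)^{2^t-1}·E₀ₜ` for every `u ∈ 𝒰ₑ`** (`pow_two_pow`): `u = 1 + X` with `X` strictly upper triangular,
`(1+X)^t = 1 + X^t` in characteristic `2` (`t` a power of `2`), and `X^t` of a strictly upper triangular `(t+1)×(t+1)` matrix is the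
corner matrix `(∏_r X_{r,r+1})·E₀ₜ` (`pow_sub_one_apply_col`), here with `∏_r λ^{2^r} = λ^{2^t-1}`.  Since `|k^×| = 2^t − 1`,
`λ^{2^t-1} = 1` for `λ ≠ 0`: **every `u` with `λ(u) ≠ 0` satisfies `u^t = c := 1 + E₀ₜ`** (`pow_two_pow_eq_c`) — a uniform root law of
exactly the kind studied by the universal groups `Γ(d,2^e)` of memo g23 §2.3 — and `u^t = 1` if `λ(u) = 0`.  `c` is a central involution
`≠ 1` of `𝒰ₑ` (§3).  Hence every NON-root of `c` lies in `ker λ`, so `𝒦(𝒰ₑ,c) = ⟨c, non-roots⟩ ≤ ker λ` (`stabGen_le_ker`) and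
`𝒰ₑ/𝒦 ↠ 𝒰ₑ/ker λ ≅ (k,+) ≅ (ℤ/2)^t`: **`d₂(𝒰ₑ/𝒦) ≥ t = 2^e`** (§4, counting characters through `card_signChar_quotient` and the
non-degenerate trace form of `k/𝔽₂`).  (For `e = 1` the subgroup generated by two such matrices over `𝔽₄` is `Q₈`; in general `𝒰ₑ` contains
the `1`-units `1 + πk{π;Frob}/(π^{t+1})` of the truncated skew-polynomial ring, i.e. of the maximal order of the central division algebra of
invariant `1/t` over `𝔽₂((T))` modulo `π^{t+1}` — the lane memo `PORTFOLIO-lit-andre-3-g24.md` §1 has this reading, the `d`-generator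
subgroups with `d(H) = d₂ = d` for every `d`, and the numerics `|H| = 2^{15}` (`t = 4`), `2^{63}` (`t = 8`).)  By memo g23 §1
(Neukirch–Schmidt–Wingberg (9.6.7)(i)) every such pair is `(Gal(F/ℚ), complex conjugation)` for a Galois CM field `F`, so `dim 𝔛` is
unbounded over Galois CM fields; that sentence is the memoʼs, not this fileʼs.

## References
* [Pohlmann1968] H. Pohlmann, Algebraic cycles on abelian varieties of complex multiplication type, Ann. of Math. 88 (1968), Thm 1.
* [Milne1999] J. S. Milne, Lefschetz motives and the Tate conjecture, Compositio Math. 117 (1999), Prop. 2.1, p. 54.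
-/

namespace Summit.HodgeConjecture.CorCM.Census.TypeStabiliser

open Summit.HodgeConjecture.CorCM.Census.IndexTwo

noncomputable section

namespace FrobUT

/-! ## §3 The group `𝒰ₑ`, its character `λ`, its generators and the central involution `c` -/

variable (e)

/-- **The Frobenius‑unitriangular group `𝒰ₑ ≤ GL_{2^e+1}(𝔽_{2^{2^e}})`.** [folklore] -/
def frobUT : Subgroup (Mat e)ˣ where
  carrier := {u | (u : Mat e) ∈ good e}
  mul_mem' := fun {u v} hu hv => by
    change ((u * v : (Mat e)ˣ) : Mat e) ∈ good e
    rw [Units.val_mul]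
    exact mul_mem_good hu hv
  one_mem' := by
    change ((1 : (Mat e)ˣ) : Mat e) ∈ good e
    rw [Units.val_one]
    exact one_mem_good
  inv_mem' := fun {u} hu => by
    change ((u⁻¹ : (Mat e)ˣ) : Mat e) ∈ good e
    have h : ((u⁻¹ : (Mat e)ˣ) : Mat e) = (u : Mat e) ^ (2 ^ (e + 1) - 1) := by
      calc ((u⁻¹ : (Mat e)ˣ) : Mat e) = (u⁻¹ : (Mat e)ˣ) * (u : Mat e) ^ (2 ^ (e + 1)) := by
            rw [pow_two_pow_succ hu, mul_one]
        _ = (u⁻¹ : (Mat e)ˣ) * (u : Mat e) * (u : Mat e) ^ (2 ^ (e + 1) - 1) := by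
            rw [mul_assoc, ← pow_succ', Nat.sub_add_cancel Nat.one_le_two_pow]
        _ = (u : Mat e) ^ (2 ^ (e + 1) - 1) := by rw [Units.inv_mul, one_mul]
    rw [h]
    exact pow_mem_good hu _

/-- Membership in `𝒰ₑ` is Frobenius‑unitriangularity of the matrix. [folklore] -/
theorem mem_frobUT {u : (Mat e)ˣ} : u ∈ frobUT e ↔ (u : Mat e) ∈ good e := Iff.rfl

/-- The underlying matrix of an element of `𝒰ₑ`. [folklore] -/
abbrev toMat (g : frobUT e) : Mat e := ((g : (Mat e)ˣ) : Mat e)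

/-- The matrix of an element of `𝒰ₑ` is Frobenius‑unitriangular. [folklore] -/
theorem toMat_mem_good (g : frobUT e) : toMat e g ∈ good e := g.2

/-- An element of `𝒰ₑ` is determined by its matrix. [folklore] -/
theorem toMat_injective : Function.Injective (toMat e) := fun _ _ h => Subtype.ext (Units.ext h)

/-- `toMat` is multiplicative. [folklore] -/
@[simp] theorem toMat_mul (g h : frobUT e) : toMat e (g * h) = toMat e g * toMat e h := rfl

/-- `toMat 1 = 1`. [folklore] -/
@[simp] theorem toMat_one : toMat e (1 : frobUT e) = 1 := rfl

/-- `toMat` commutes with powers. [folklore] -/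
@[simp] theorem toMat_pow (g : frobUT e) (k : ℕ) : toMat e (g ^ k) = toMat e g ^ k := by
  rw [toMat, Subgroup.coe_pow, Units.val_pow_eq_pow_val]

/-- **The character `λ : 𝒰ₑ → (k, +)`**, `u ↦ u_{0,1}`. [folklore] -/
def lamHom : frobUT e →* Multiplicative (Fq e) where
  toFun g := Multiplicative.ofAdd (lam e (toMat e g))
  map_one' := by rw [toMat_one, lam_one, ofAdd_zero]
  map_mul' g h := by rw [toMat_mul, lam_mul (toMat_mem_good e g) (toMat_mem_good e h), ofAdd_add]

/-- `λ` on an element of `𝒰ₑ` is the `(0,1)` entry of its matrix. [folklore] -/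
@[simp] theorem lamHom_apply (g : frobUT e) : lamHom e g = Multiplicative.ofAdd (lam e (toMat e g)) := rfl

/-- The generator matrix `g(w) = 1 + Σ_r w^{2^r} E_{r,r+1}`. [folklore] -/
def genMat (w : Fq e) : Mat e :=
  1 + Matrix.of fun i j : Fin (2 ^ e + 1) => if (j : ℕ) = i + 1 then w ^ (2 ^ (i : ℕ)) else 0

/-- The superdiagonal of the generator matrix `g(w)` is `w^{2^r}`. [folklore] -/
theorem sd_genMat (w : Fq e) (r : Fin (2 ^ e)) : sd e (genMat e w) r = w ^ (2 ^ (r : ℕ)) := by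
  unfold sd genMat
  rw [Matrix.add_apply, Matrix.one_apply_ne (castSucc_ne_succ r), zero_add, Matrix.of_apply,
    Fin.val_succ, Fin.val_castSucc, if_pos rfl]

/-- `λ(g(w)) = w`. [folklore] -/
theorem lam_genMat (w : Fq e) : lam e (genMat e w) = w := by
  rw [lam, sd_genMat, pow_zero, pow_one]

/-- The generator matrix `g(w)` is Frobenius‑unitriangular. [folklore] -/
theorem genMat_mem_good (w : Fq e) : genMat e w ∈ good e :=
  ⟨fun i => by
    unfold genMat
    rw [Matrix.add_apply, Matrix.one_apply_eq, Matrix.of_apply, if_neg (by omega), add_zero],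
  fun i j h => by
    unfold genMat
    rw [Matrix.add_apply, Matrix.one_apply_ne, Matrix.of_apply, if_neg (by omega), add_zero]
    intro hij
    subst hij
    exact lt_irrefl _ h,
  fun r => by rw [sd_genMat, lam_genMat]⟩

/-- The generator `g(w) ∈ 𝒰ₑ` with `λ(g(w)) = w`. [folklore] -/
def gen (w : Fq e) : frobUT e := ⟨goodUnit (genMat_mem_good e w), genMat_mem_good e w⟩

/-- The matrix of the generator `g(w)`. [folklore] -/
@[simp] theorem toMat_gen (w : Fq e) : toMat e (gen e w) = genMat e w := rfl

/-- `λ(g(w)) = w` in `𝒰ₑ`. [folklore] -/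
theorem lamHom_gen (w : Fq e) : lamHom e (gen e w) = Multiplicative.ofAdd w := by
  rw [lamHom_apply, toMat_gen, lam_genMat]

/-- **`λ` is surjective.** [folklore] -/
theorem lamHom_surjective : Function.Surjective (lamHom e) := fun x =>
  ⟨gen e (Multiplicative.toAdd x), by rw [lamHom_gen, ofAdd_toAdd]⟩

/-- **The element `c := g(1)^{2^e} ∈ 𝒰ₑ`**, whose matrix is `1 + E₀ₜ`. [folklore] -/
def c : frobUT e := gen e 1 ^ 2 ^ e

/-- `#𝔽_{2^{2^e}} = 2^{2^e}`. [folklore] -/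
theorem card_Fq : Nat.card (Fq e) = 2 ^ (2 ^ e) := GaloisField.card 2 (2 ^ e) (pow_ne_zero e two_ne_zero)

/-- `x^{2^{2^e}-1} = 1` for `x ≠ 0` in `𝔽_{2^{2^e}}`. [folklore] -/
theorem pow_card_sub_one {x : Fq e} (hx : x ≠ 0) : x ^ (2 ^ (2 ^ e) - 1) = 1 := by
  haveI : Fintype (Fq e) := Fintype.ofFinite _
  have hcard : Fintype.card (Fq e) = 2 ^ (2 ^ e) := by rw [← Nat.card_eq_fintype_card]; exact card_Fq e
  rw [← hcard]
  exact FiniteField.pow_card_sub_one_eq_one x hx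

/-- The matrix of `c` is `1 + E₀ₜ`. [folklore] -/
theorem toMat_c : toMat e (c e) = 1 + cornerE e := by
  rw [c, toMat_pow, toMat_gen, pow_two_pow (genMat_mem_good e 1), lam_genMat, one_pow, one_smul]

variable {e}

/-- **THE ROOT LAW: `g^{2^e} = c` for every `g ∈ 𝒰ₑ` with `λ(g) ≠ 0`.** [folklore] -/
theorem pow_two_pow_eq_c {g : frobUT e} (hg : lam e (toMat e g) ≠ 0) : g ^ 2 ^ e = c e := by
  apply toMat_injective
  rw [toMat_pow, toMat_c, pow_two_pow (toMat_mem_good e g), pow_card_sub_one e hg, one_smul]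

/-- `g^{2^e} = 1` for every `g ∈ 𝒰ₑ` with `λ(g) = 0`. [folklore] -/
theorem pow_two_pow_eq_one {g : frobUT e} (hg : lam e (toMat e g) = 0) : g ^ 2 ^ e = 1 := by
  apply toMat_injective
  rw [toMat_pow, toMat_one, pow_two_pow (toMat_mem_good e g), hg, zero_pow, zero_smul, add_zero]
  exact Nat.sub_ne_zero_of_lt (Nat.one_lt_two_pow (pow_ne_zero e two_ne_zero))

/-- Every element of `𝒰ₑ` has order dividing `2^{e+1}`. [folklore] -/
theorem pow_two_pow_succ_eq_one (g : frobUT e) : g ^ 2 ^ (e + 1) = 1 := by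
  apply toMat_injective
  rw [toMat_pow, toMat_one, pow_two_pow_succ (toMat_mem_good e g)]

variable (e)

/-- `c² = 1`. [folklore] -/
theorem c_mul_c : c e * c e = 1 := by
  apply toMat_injective
  rw [toMat_mul, toMat_c, toMat_one, ← one_smul (Fq e) (cornerE e), one_add_smul_cornerE_sq]

/-- `c ≠ 1`. [folklore] -/
theorem c_ne_one : c e ≠ 1 := by
  intro h
  have h1 := congrArg (toMat e) h
  rw [toMat_c, toMat_one] at h1
  have h2 := congr_fun (congr_fun h1 0) (Fin.last (2 ^ e))
  rw [Matrix.add_apply, cornerE_apply, if_pos ⟨rfl, rfl⟩, Matrix.one_apply_ne (last_ne_zero).symm, zero_add] at h2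
  exact one_ne_zero h2

/-- `c` is central in `𝒰ₑ` (`E₀ₜ` is absorbed by unitriangular matrices on both sides). [folklore] -/
theorem c_comm (x : frobUT e) : x * c e = c e * x := by
  apply toMat_injective
  rw [toMat_mul, toMat_mul, toMat_c, mul_add, add_mul, mul_one, one_mul, mul_cornerE (toMat_mem_good e x),
    cornerE_mul (toMat_mem_good e x)]

/-- `λ(c) = 0` (for `e ≠ 0`, i.e. matrix size `≥ 3`). [folklore] -/
theorem lam_toMat_c (he : e ≠ 0) : lam e (toMat e (c e)) = 0 := by
  rw [toMat_c, lam, sd, Matrix.add_apply, Matrix.one_apply_ne (castSucc_ne_succ _), zero_add, cornerE_apply, if_neg]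
  rintro ⟨-, h⟩
  have h' := congrArg Fin.val h
  rw [Fin.val_last, Fin.val_succ, Fin.val_mk] at h'
  have h1 : 2 ^ e = 1 := by omega
  exact absurd h1 (Nat.one_lt_two_pow he).ne'

/-- **`𝒦(𝒰ₑ, c) ≤ ker λ`**: `c ∈ ker λ`, and a non-root of `c` has `λ = 0` by the root law. [folklore] -/
theorem stabGen_le_ker (he : e ≠ 0) : stabGen (c e) ≤ (lamHom e).ker := by
  rw [stabGen_le_iff_subset]
  refine ⟨?_, fun g hg => ?_⟩
  · rw [MonoidHom.mem_ker, lamHom_apply, lam_toMat_c e he, ofAdd_zero]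
  · rw [MonoidHom.mem_ker, lamHom_apply]
    by_contra h
    apply hg
    have hne : lam e (toMat e g) ≠ 0 := fun h0 => h (by rw [h0, ofAdd_zero])
    rw [← pow_two_pow_eq_c hne]
    exact Subgroup.pow_mem _ (Subgroup.mem_zpowers g) _

/-! ## §4 Counting characters: `d₂(𝒰ₑ/𝒦) ≥ 2^e` -/

/-- The trace characters `x ↦ Tr_{k/𝔽₂}(a x)` of `(k, +)`. [folklore] -/
def trChar (a : Fq e) : Multiplicative (Fq e) →* Multiplicative (ZMod 2) :=
  AddMonoidHom.toMultiplicative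
    ((Algebra.trace (ZMod 2) (Fq e)).toAddMonoidHom.comp (AddMonoidHom.mulLeft a))

/-- Values of the trace characters. [folklore] -/
theorem trChar_apply (a x : Fq e) :
    trChar e a (Multiplicative.ofAdd x) = Multiplicative.ofAdd (Algebra.trace (ZMod 2) (Fq e) (a * x)) := rfl

/-- `a ↦ Tr(a·)` is injective (the trace form of `k/𝔽₂` is non-degenerate). [folklore] -/
theorem trChar_injective : Function.Injective (trChar e) := by
  intro a b hab
  have h : ∀ x : Fq e, Algebra.trace (ZMod 2) (Fq e) (a * x) = Algebra.trace (ZMod 2) (Fq e) (b * x) := fun x => by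
    have hx := DFunLike.congr_fun hab (Multiplicative.ofAdd x)
    rw [trChar_apply, trChar_apply] at hx
    exact Multiplicative.ofAdd.injective hx
  have hab' : a - b = 0 := (traceForm_nondegenerate (ZMod 2) (Fq e)).1 (a - b) fun x => by
    rw [Algebra.traceForm_apply, sub_mul, map_sub, h x, sub_self]
  exact sub_eq_zero.mp hab'

/-- `#Hom((k,+), ℤ/2) ≥ #k = 2^{2^e}`. [folklore] -/
theorem card_le_card_addChar : 2 ^ (2 ^ e) ≤ Nat.card (Multiplicative (Fq e) →* Multiplicative (ZMod 2)) := by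
  rw [← card_Fq e]
  exact Nat.card_le_card_of_injective (trChar e) (trChar_injective e)

/-- **`d₂(𝒰ₑ/𝒦(𝒰ₑ,c)) ≥ 2^e`** (`e ≠ 0`): `𝒰ₑ/𝒦 ↠ 𝒰ₑ/ker λ ≅ (k,+)`, so the `2^{2^e}` characters of `(k,+)` pull back to distinct
characters of `𝒰ₑ/𝒦`, whose number is `2^{d₂}` (`card_signChar_quotient`). [folklore] -/
theorem two_pow_le_indexTwoRank_stabGen (he : e ≠ 0) : 2 ^ e ≤ indexTwoRank (stabGen (c e)) := by
  haveI hN : (stabGen (c e)).Normal := stabGen_normal _ (c_comm e)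
  let Λ : frobUT e ⧸ stabGen (c e) →* Multiplicative (Fq e) :=
    QuotientGroup.lift (stabGen (c e)) (lamHom e) (stabGen_le_ker e he)
  have hΛ : Function.Surjective Λ := fun y => by
    obtain ⟨g, hg⟩ := lamHom_surjective e y
    exact ⟨QuotientGroup.mk g, by rw [QuotientGroup.lift_mk]; exact hg⟩
  have h1 : Nat.card (Multiplicative (Fq e) →* Multiplicative (ZMod 2)) ≤
      Nat.card (frobUT e ⧸ stabGen (c e) →* Multiplicative (ZMod 2)) :=
    Nat.card_le_card_of_injective (fun ψ => ψ.comp Λ) fun ψ₁ ψ₂ h => (MonoidHom.cancel_right hΛ).mp h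
  rw [card_signChar_quotient] at h1
  exact (Nat.pow_le_pow_iff_right (by norm_num)).mp ((card_le_card_addChar e).trans h1)

end FrobUT

/-! ## §5 The headline: `d₂(G/𝒦)` is unbounded -/

/-- **`d₂(G/𝒦(G,c))` IS UNBOUNDED**: for every `d` there is a finite group `G` (a `2`-group of upper unitriangular matrices over
`𝔽_{2^{2^{d+1}}}`) with a central involution `c ≠ 1` and `d₂(G/𝒦(G,c)) ≥ d` — hence (by `Census/TypeStabiliserCharK`) pairs with
`dim_𝔽₂ 𝔛(G,c)` as large as desired. [folklore] -/
theorem exists_indexTwoRank_stabGen_ge (d : ℕ) :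
    ∃ (G : Type) (_ : Group G) (_ : Finite G) (c : G),
      c * c = 1 ∧ c ≠ 1 ∧ (∀ x : G, x * c = c * x) ∧ d ≤ indexTwoRank (stabGen c) :=
  ⟨FrobUT.frobUT (d + 1), inferInstance, inferInstance, FrobUT.c (d + 1), FrobUT.c_mul_c _, FrobUT.c_ne_one _,
    FrobUT.c_comm _,
    ((Nat.lt_two_pow_self).le.trans (Nat.pow_le_pow_right two_pos (Nat.le_succ d))).trans
      (FrobUT.two_pow_le_indexTwoRank_stabGen (d + 1) (Nat.succ_ne_zero d))⟩

end

end Summit.HodgeConjecture.CorCM.Census.TypeStabiliser
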